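import Literature.NumberTheory.LFunctions.WeilMarkovQuadratic
import Literature.NumberTheory.LFunctions.WeilWindowSuzukiProofs
import HarnessLib

/-!
# RiemannHypothesis / GroundBarta — crux `PolarPerronFrobenius` (stmt-RiemannHypothesis-18390):
# THIN-LAYER LOG-COERCIVITY of the Markov part of Weil's form (RH-free engine of the
# harmonic-majorant line, part 1: the translation-gap identity and the structural lower bound)

Helper file (`--supports stmt-RiemannHypothesis-18390`), RH-free, Mathlib + proved Literature files
only, no definitions, no named facts.

**What is proved.**  Write `N(g) = ‖g‖₂²`, `D_t(g) = ∫ |g(x+t) − g(x)|² dx` (`weilIncrement`),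
`w(t) = e^{t/2}/(2 sinh t)` (`weilArchDensity`), `Q₀ = weilMarkovQuadratic` (`Re Q − P`, the
pole-removed part of Weil's form) and recall the Markov decomposition on a window `[-a, a]`
(`weilMarkovQuadratic_eq_weilDirichletEnergy_sub`, Bombieri 2000 Thm 2):
`Q₀(g) = Σ_{log n < 2a} Λ(n) n^{-1/2} D_{log n}(g) + ∫₀^∞ w(t) D_t(g) dt − M_a N(g)`,
`M_a = 2Σ_{log n<2a} Λ(n)n^{-1/2} + c_A`, `c_A = 2∫₀^∞ (e^{t/2} − 1)/(2 sinh t) dt + log 4π + γ`.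

1. TRANSLATION GAPS (`tl_weilIncrement_eq_two_mul_of_gap`): if `tsupport g ⊆ S` and the translate
   `S − t` misses `S` (`x ∈ S ⇒ x + t ∉ S`), then `D_t(g) = 2 N(g)` — the translate and `g` have
   disjoint supports.
2. STRUCTURAL LOWER BOUND (`tl_weilDirichletEnergy_ge`, `tl_weilMarkovQuadratic_ge`): for a set `T`
   of positive translation gaps and a set `P` of prime powers whose lengths `log n` are gaps,
   `𝓔_a(g) ≥ 2N(g)·(∫_T w + Σ_{n∈P} Λ(n)n^{-1/2})`, hence
   `Q₀(g) ≥ N(g)·(2∫_T w − c_A − 2Σ_{n ∈ I_a \ P} Λ(n) n^{-1/2})`: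
   the NON-RESONANT prime rates cancel their share of the killing constant EXACTLY, and the
   archimedean density pays on every gap.
3. ONE THIN LAYER (`tl_weilMarkovQuadratic_ge_of_thinLayer`): if `tsupport g ⊆ [c, c + ζ]` with
   `0 < ζ < log 2` (inside some window), every `t > ζ` and every prime length is a gap, so
   `Q₀(g) ≥ (2∫_ζ^∞ w − c_A)·N(g)` — WINDOW-FREE: no prime enters at all.  Since
   `2∫_ζ^∞ w = log(1/ζ) + O(1)`, this is the logarithmic coercivity of `Q₀` on thin supports
   (the analogue, for Weil's jump form, of the Faber–Krahn law `λ₁(B_r) = λ₁(B_1) + 2 log(1/r)`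
   of the logarithmic Laplacian, Chen–Weth 2019 §4; Feulefack–Jarohs–Weth 2020 Prop. 5.5).
4. TWO LAYERS (`tl_weilMarkovQuadratic_ge_of_twoLayers`): for `tsupport g ⊆ [c₁, c₁+ζ] ∪ [c₂, c₂+ζ]`,
   `d = c₂ − c₁ ≥ 2ζ`, the only non-gaps are `t ≤ ζ` and the RESONANT BAND `|t − d| ≤ ζ`:
   `Q₀(g) ≥ N(g)·(2∫_{(ζ,∞) \ [d−ζ, d+ζ]} w − c_A − 2Σ_{n∈I_a, |log n − d| ≤ ζ} Λ(n)n^{-1/2})`.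
   With `c₁ = -a`, `c₂ = a − ζ` these are the two EDGE LAYERS of the window, the support of the
   edge-layer negative part `(Re u)⁻ 𝟙_{a−ζ<|t|<a}` of an even ground state — the test used by the
   harmonic-majorant line (card `Cruxes/PolarPerronFrobenius/Ideas/harmonic-majorant-edge-source.md`,
   engine `EdgeLayerCoercive`); the numerical evaluation (`κ = a/2` at `ζ_a = e^{-a}/(8a)`,
   eventually in `a`) is part 2 (`…ThinLayerCoerciveEventually.lean`).

References: E. Bombieri, Rend. Lincei (9) 11 (2000) Thm 2 (Markov decomposition, tree file
`WeilMarkovQuadratic`); H. Chen, T. Weth, Comm. PDE 44 (2019) §4 and P. A. Feulefack, S. Jarohs,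
T. Weth, arXiv:2010.10448 Prop. 5.5 (small-volume coercivity / maximum principle for the
logarithmic Laplacian — the model statement; nothing of it is used).  Prover B, speedrun unit
`sr-gb-rung-b` (seat 2).
-/

set_option linter.dupNamespace false

noncomputable section

open Set MeasureTheory Filter Complex
open scoped Real Topology

namespace Summit.RiemannHypothesis.RiemannHypothesis.Theorems.PolarPerronFrobenius

open Literature.NumberTheory.LFunctions
open scoped ArithmeticFunction.vonMangoldt

/-! ## Translation gaps -/

section Gap

variable {g : ℝ → ℂ} {S : Set ℝ}

/-- **Translation gap ⇒ constant increment.**  If `tsupport g ⊆ S` and `x ∈ S ⇒ x + t ∉ S`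
(the translate of the support by `-t` misses the support), then `D_t(g) = 2‖g‖₂²`: pointwise
`|g(x+t) − g(x)|² = |g(x+t)|² + |g(x)|²` because one of the two values vanishes. [folklore] -/
theorem tl_weilIncrement_eq_two_mul_of_gap (hg : IsWeilTest g) (hS : tsupport g ⊆ S) {t : ℝ}
    (ht : ∀ x ∈ S, x + t ∉ S) : weilIncrement g t = 2 * ∫ x : ℝ, ‖g x‖ ^ 2 := by
  have hpt : ∀ x : ℝ, ‖g (x + t) - g x‖ ^ 2 = ‖g (x + t)‖ ^ 2 + ‖g x‖ ^ 2 := by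
    intro x
    by_cases hx : x ∈ S
    · have h0 : g (x + t) = 0 := image_eq_zero_of_notMem_tsupport fun h ↦ ht x hx (hS h)
      simp [h0]
    · have h0 : g x = 0 := image_eq_zero_of_notMem_tsupport fun h ↦ hx (hS h)
      simp [h0]
  unfold weilIncrement
  simp_rw [hpt]
  rw [integral_add (hg.integrable_norm_sq.comp_add_right t) hg.integrable_norm_sq,
    integral_add_right_eq_self (fun u : ℝ ↦ ‖g u‖ ^ 2) t]
  ring

end Gap

/-! ## The structural lower bound -/

section Structural

variable {g : ℝ → ℂ} {S T : Set ℝ} {a : ℝ}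

/-- **Energy on the gaps.**  For a test `g` with `tsupport g ⊆ S`, a measurable set `T ⊆ (0, ∞)`
of translation gaps of `S` and a set `P ⊆ I_a` of prime powers whose lengths are gaps,
`2‖g‖₂² (∫_T w + Σ_{n∈P} Λ(n) n^{-1/2}) ≤ 𝓔_a(g)` (drop the other, non-negative, terms and use
`D_t(g) = 2‖g‖₂²` on the gaps). [folklore] -/
theorem tl_weilDirichletEnergy_ge (hg : IsWeilTest g) (hS : tsupport g ⊆ S)
    (hT : MeasurableSet T) (hT0 : T ⊆ Ioi 0) (hgap : ∀ t ∈ T, ∀ x ∈ S, x + t ∉ S)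
    {P : Finset ℕ} (hP : P ⊆ weilPrimeIndex a) (hPgap : ∀ n ∈ P, ∀ x ∈ S, x + Real.log n ∉ S) :
    2 * (∫ x : ℝ, ‖g x‖ ^ 2) * ((∫ t in T, weilArchDensity t) + ∑ n ∈ P, (Λ n : ℝ) / Real.sqrt n) ≤
      weilDirichletEnergy a g := by
  set N : ℝ := ∫ x : ℝ, ‖g x‖ ^ 2 with hN
  have hN0 : 0 ≤ N := integral_nonneg fun x ↦ by positivity
  -- archimedean part
  have harch : 2 * N * ∫ t in T, weilArchDensity t ≤
      ∫ t in Ioi (0 : ℝ), weilArchDensity t * weilIncrement g t := by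
    have hT' : ∫ t in T, weilArchDensity t * weilIncrement g t = 2 * N * ∫ t in T, weilArchDensity t := by
      rw [← integral_const_mul]
      refine setIntegral_congr_fun hT fun t ht ↦ ?_
      rw [tl_weilIncrement_eq_two_mul_of_gap hg hS (hgap t ht)]
      ring
    rw [← hT']
    exact setIntegral_mono_set (integrableOn_weilArchDensity_mul_weilIncrement hg)
      ((ae_restrict_iff' measurableSet_Ioi).2 (Eventually.of_forall fun t (ht : 0 < t) ↦
        mul_nonneg (weilArchDensity_pos ht).le (weilIncrement_nonneg g t)))
      (Eventually.of_forall hT0)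
  -- prime part
  have hprime : 2 * N * ∑ n ∈ P, (Λ n : ℝ) / Real.sqrt n ≤
      ∑ n ∈ weilPrimeIndex a, (Λ n : ℝ) / Real.sqrt n * weilIncrement g (Real.log n) := by
    have hP' : ∑ n ∈ P, (Λ n : ℝ) / Real.sqrt n * weilIncrement g (Real.log n) =
        2 * N * ∑ n ∈ P, (Λ n : ℝ) / Real.sqrt n := by
      rw [Finset.mul_sum]
      refine Finset.sum_congr rfl fun n hn ↦ ?_
      rw [tl_weilIncrement_eq_two_mul_of_gap hg hS (hPgap n hn)]
      ring
    rw [← hP']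
    exact Finset.sum_le_sum_of_subset_of_nonneg hP fun n _ _ ↦
      mul_nonneg (div_nonneg ArithmeticFunction.vonMangoldt_nonneg (Real.sqrt_nonneg _))
        (weilIncrement_nonneg g _)
  unfold weilDirichletEnergy
  nlinarith [harch, hprime]

/-- **The structural lower bound for the Markov part.**  Under the hypotheses of
`tl_weilDirichletEnergy_ge` and `tsupport g ⊆ [-a, a]`,
`‖g‖₂² · (2∫_T w − c_A − 2 Σ_{n ∈ I_a \ P} Λ(n) n^{-1/2}) ≤ Q₀(g)`,
`c_A = 2∫₀^∞ (e^{t/2}−1)/(2 sinh t) dt + log 4π + γ`: the prime rates at gap lengths cancel their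
share `2Σ_{n∈P} Λ(n)n^{-1/2}` of the killing constant exactly. [folklore] -/
theorem tl_weilMarkovQuadratic_ge (hg : IsWeilTest g) (hS : tsupport g ⊆ S)
    (hwin : tsupport g ⊆ Icc (-a) a)
    (hT : MeasurableSet T) (hT0 : T ⊆ Ioi 0) (hgap : ∀ t ∈ T, ∀ x ∈ S, x + t ∉ S)
    {P : Finset ℕ} (hP : P ⊆ weilPrimeIndex a) (hPgap : ∀ n ∈ P, ∀ x ∈ S, x + Real.log n ∉ S) :
    (∫ x : ℝ, ‖g x‖ ^ 2) *
        (2 * (∫ t in T, weilArchDensity t) -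
          (2 * (∫ t in Ioi (0 : ℝ), (Real.exp (t / 2) - 1) / (2 * Real.sinh t)) +
            (Real.log (4 * π) + Real.eulerMascheroniConstant)) -
          2 * ∑ n ∈ weilPrimeIndex a \ P, (Λ n : ℝ) / Real.sqrt n) ≤
      weilMarkovQuadratic g := by
  have hE := tl_weilDirichletEnergy_ge hg hS hT hT0 hgap hP hPgap
  have hsplit : ∑ n ∈ weilPrimeIndex a, (Λ n : ℝ) / Real.sqrt n =
      ∑ n ∈ P, (Λ n : ℝ) / Real.sqrt n + ∑ n ∈ weilPrimeIndex a \ P, (Λ n : ℝ) / Real.sqrt n :=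
    by rw [← Finset.sum_sdiff hP, add_comm]
  rw [weilMarkovQuadratic_eq_weilDirichletEnergy_sub hg hwin]
  unfold weilMarkovConstant
  rw [hsplit]
  have hN0 : 0 ≤ ∫ x : ℝ, ‖g x‖ ^ 2 := integral_nonneg fun x ↦ by positivity
  nlinarith [hE, hN0]

end Structural

/-! ## One thin layer: window-free logarithmic coercivity -/

section OneLayer

variable {g : ℝ → ℂ} {c ζ : ℝ}

/-- The prime powers `n ≤ 1` carry no rate: `Λ(n) n^{-1/2} = 0` for `n < 2`. [folklore] -/
theorem tl_vonMangoldt_div_sqrt_eq_zero {n : ℕ} (hn : n < 2) : (Λ n : ℝ) / Real.sqrt n = 0 := by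
  interval_cases n <;> simp [ArithmeticFunction.vonMangoldt_apply_one]

/-- A prime power `n ≥ 2` has length `log n ≥ log 2`. [folklore] -/
theorem tl_log_two_le_log {n : ℕ} (hn : 2 ≤ n) : Real.log 2 ≤ Real.log n :=
  Real.log_le_log two_pos (by exact_mod_cast hn)

/-- **One thin layer (exact form).**  If `tsupport g ⊆ [c, c + ζ]` with `0 < ζ < log 2`, then
`‖g‖₂² · (2∫_{(ζ,∞)} w − c_A) ≤ Q₀(g)`,
`c_A = 2∫₀^∞ (e^{t/2} − 1)/(2 sinh t) dt + log 4π + γ`.  WINDOW-FREE: every `t > ζ` and every prime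
length `log n ≥ log 2 > ζ` is a translation gap of the layer, so no prime enters and the bound
does not see the window in which the layer sits. [folklore] -/
theorem tl_weilMarkovQuadratic_ge_of_thinLayer (hg : IsWeilTest g) (hζ : 0 < ζ)
    (hζ2 : ζ < Real.log 2) (hS : tsupport g ⊆ Icc c (c + ζ)) :
    (∫ x : ℝ, ‖g x‖ ^ 2) *
        (2 * (∫ t in Ioi ζ, weilArchDensity t) -
          (2 * (∫ t in Ioi (0 : ℝ), (Real.exp (t / 2) - 1) / (2 * Real.sinh t)) +
            (Real.log (4 * π) + Real.eulerMascheroniConstant))) ≤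
      weilMarkovQuadratic g := by
  -- a window containing the layer
  set a : ℝ := max |c| |c + ζ| with ha
  have hwin : tsupport g ⊆ Icc (-a) a := by
    intro x hx
    have hx' := hS hx
    constructor
    · have : -a ≤ -|c| := by simp [ha]
      linarith [neg_abs_le c, hx'.1]
    · exact hx'.2.trans ((le_abs_self _).trans (le_max_right _ _))
  -- gaps
  have hgap : ∀ t ∈ Ioi ζ, ∀ x ∈ Icc c (c + ζ), x + t ∉ Icc c (c + ζ) := by
    intro t ht x hx hxt
    have : ζ < t := ht
    linarith [hx.1, hxt.2]
  set P : Finset ℕ := (weilPrimeIndex a).filter (fun n ↦ 2 ≤ n) with hPdef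
  have hP : P ⊆ weilPrimeIndex a := Finset.filter_subset _ _
  have hPgap : ∀ n ∈ P, ∀ x ∈ Icc c (c + ζ), x + Real.log n ∉ Icc c (c + ζ) := by
    intro n hn x hx hxt
    have hn2 : 2 ≤ n := (Finset.mem_filter.1 hn).2
    have hlog := tl_log_two_le_log hn2
    linarith [hx.1, hxt.2]
  have hzero : ∑ n ∈ weilPrimeIndex a \ P, (Λ n : ℝ) / Real.sqrt n = 0 := by
    refine Finset.sum_eq_zero fun n hn ↦ ?_
    have hn' := Finset.mem_sdiff.1 hn
    have hlt : n < 2 := by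
      by_contra h
      exact hn'.2 (Finset.mem_filter.2 ⟨hn'.1, not_lt.1 h⟩)
    exact tl_vonMangoldt_div_sqrt_eq_zero hlt
  have h := tl_weilMarkovQuadratic_ge hg hS hwin measurableSet_Ioi
    (fun t (ht : ζ < t) ↦ lt_trans hζ ht) hgap hP hPgap
  rw [hzero, mul_zero, sub_zero] at h
  exact h

end OneLayer

/-! ## Two layers: the resonant band -/

section TwoLayers

variable {g : ℝ → ℂ} {a c₁ c₂ ζ : ℝ}

/-- **Two layers (exact form).**  If `tsupport g ⊆ [c₁, c₁+ζ] ∪ [c₂, c₂+ζ] ⊆ [-a, a]` with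
`0 < ζ < log 2` and separation `d = c₂ − c₁ ≥ 2ζ`, then with the RESONANT BAND `|t − d| ≤ ζ`
removed from the gaps,
`‖g‖₂² · (2∫_{(ζ,∞) \ [d−ζ, d+ζ]} w − c_A − 2 Σ_{n∈I_a, |log n − d| ≤ ζ} Λ(n)n^{-1/2}) ≤ Q₀(g)`.
For `c₁ = -a`, `c₂ = a − ζ` these are the two edge layers of the window (`d = 2a − ζ`, band
`[2a − 2ζ, 2a]`). [folklore] -/
theorem tl_weilMarkovQuadratic_ge_of_twoLayers (hg : IsWeilTest g) (hζ : 0 < ζ)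
    (hζ2 : ζ < Real.log 2) (hd : 2 * ζ ≤ c₂ - c₁)
    (hS : tsupport g ⊆ Icc c₁ (c₁ + ζ) ∪ Icc c₂ (c₂ + ζ))
    (hwin : tsupport g ⊆ Icc (-a) a) :
    (∫ x : ℝ, ‖g x‖ ^ 2) *
        (2 * (∫ t in Ioi ζ \ Icc (c₂ - c₁ - ζ) (c₂ - c₁ + ζ), weilArchDensity t) -
          (2 * (∫ t in Ioi (0 : ℝ), (Real.exp (t / 2) - 1) / (2 * Real.sinh t)) +
            (Real.log (4 * π) + Real.eulerMascheroniConstant)) -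
          2 * ∑ n ∈ (weilPrimeIndex a).filter (fun n : ℕ ↦ |Real.log (n : ℝ) - (c₂ - c₁)| ≤ ζ),
            (Λ n : ℝ) / Real.sqrt n) ≤
      weilMarkovQuadratic g := by
  set S : Set ℝ := Icc c₁ (c₁ + ζ) ∪ Icc c₂ (c₂ + ζ) with hSdef
  set d : ℝ := c₂ - c₁ with hddef
  -- a translation by `t > ζ` off the band is a gap
  have hgap' : ∀ t : ℝ, ζ < t → (t < d - ζ ∨ d + ζ < t) → ∀ x ∈ S, x + t ∉ S := by
    intro t ht hband x hx hxt
    rcases hx with hx | hx <;> rcases hxt with hxt | hxt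
    · linarith [hx.1, hxt.2]
    · rcases hband with hb | hb
      · linarith [hx.2, hxt.1]
      · linarith [hx.1, hxt.2]
    · linarith [hx.1, hxt.2]
    · linarith [hx.1, hxt.2]
  set T : Set ℝ := Ioi ζ \ Icc (d - ζ) (d + ζ) with hTdef
  have hT : MeasurableSet T := measurableSet_Ioi.diff measurableSet_Icc
  have hT0 : T ⊆ Ioi 0 := fun t ht ↦ lt_trans hζ ht.1
  have hgap : ∀ t ∈ T, ∀ x ∈ S, x + t ∉ S := by
    intro t ht
    refine hgap' t ht.1 ?_
    have h2 : ¬ (d - ζ ≤ t ∧ t ≤ d + ζ) := ht.2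
    by_cases h3 : t < d - ζ
    · exact Or.inl h3
    · exact Or.inr (lt_of_not_ge fun h4 ↦ h2 ⟨le_of_not_gt h3, h4⟩)
  set P : Finset ℕ := (weilPrimeIndex a).filter
    (fun n ↦ 2 ≤ n ∧ ¬ |Real.log n - d| ≤ ζ) with hPdef
  have hP : P ⊆ weilPrimeIndex a := Finset.filter_subset _ _
  have hPgap : ∀ n ∈ P, ∀ x ∈ S, x + Real.log n ∉ S := by
    intro n hn
    obtain ⟨-, hn2, hband⟩ := Finset.mem_filter.1 hn
    refine hgap' _ (lt_of_lt_of_le hζ2 (tl_log_two_le_log hn2)) ?_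
    rw [abs_le, not_and_or, not_le, not_le] at hband
    rcases hband with h3 | h3
    · exact Or.inl (by linarith)
    · exact Or.inr (by linarith)
  -- the complementary prime sum is the band sum (terms with `n < 2` vanish)
  have hcompl : ∑ n ∈ weilPrimeIndex a \ P, (Λ n : ℝ) / Real.sqrt n ≤
      ∑ n ∈ (weilPrimeIndex a).filter (fun n : ℕ ↦ |Real.log (n : ℝ) - d| ≤ ζ),
        (Λ n : ℝ) / Real.sqrt n := by
    rw [← Finset.sum_filter_of_ne (p := fun n : ℕ ↦ |Real.log (n : ℝ) - d| ≤ ζ)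
      (s := weilPrimeIndex a \ P) (fun n hn hne ↦ ?_)]
    · refine Finset.sum_le_sum_of_subset_of_nonneg (fun n hn ↦ ?_) fun n _ _ ↦
        div_nonneg ArithmeticFunction.vonMangoldt_nonneg (Real.sqrt_nonneg _)
      have hn' := Finset.mem_filter.1 hn
      exact Finset.mem_filter.2 ⟨(Finset.mem_sdiff.1 hn'.1).1, hn'.2⟩
    · have hn' := Finset.mem_sdiff.1 hn
      have hn2 : 2 ≤ n := by
        by_contra h
        exact hne (tl_vonMangoldt_div_sqrt_eq_zero (not_le.1 h))
      by_contra hband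
      exact hn'.2 (Finset.mem_filter.2 ⟨hn'.1, hn2, hband⟩)
  have h := tl_weilMarkovQuadratic_ge hg hS hwin hT hT0 hgap hP hPgap
  have hN0 : 0 ≤ ∫ x : ℝ, ‖g x‖ ^ 2 := integral_nonneg fun x ↦ by positivity
  nlinarith [h, hcompl, hN0]

end TwoLayers

end Summit.RiemannHypothesis.RiemannHypothesis.Theorems.PolarPerronFrobenius

end
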